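import Summits.BirchSwinnertonDyer.BirchSwinnertonDyer.Theorems.SylvesterTwoHeegnerIndexHeegnerIndexUpperAtTwoHSYWitness
import HarnessLib

/-!
# Route `SylvesterTwoHeegnerIndex` (rung K7t), crux `HeegnerIndexLowerAtTwoHSY` (item 19230):
# GRADED per-member certificate consumers for the LOWER half of the `2`-adic Heegner-index identity
# (helper toward stmt-BirchSwinnertonDyer-19230; cell «bsd-cm», seat `bsd-cm-k7t-c3` g2; theorems only)

HONEST FRAMING (cell «bsd-cm», `run/shared/lean/pub/bsd-cm/`; FULL-BSD RANK ≤ 1 programme, tranche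
1a): the class 𝒞_HSY at `p = 2` (B14 / O12: `BSD(E_p, 2)` for the Sylvester curves
`E_p : x³ + y³ = p`, `p ≡ 4, 7 (mod 9)` prime, `3 ∉ 𝔽_p^{×3}`) is OPEN in print and stays open here;
the crux `HeegnerIndexLowerAtTwoHSY` — modulo the route's support item `PublishedFactsTwo` it is
exactly `∀ p, ord₂ #Ш_an(E_p) ≤ ord₂ #Ш(E_p)`
(`SylvesterTwoLower.heegnerIndexLowerAtTwoHSY_iff_missingLowerBoundAt_onFamily`, p417655) —
quantifies over ALL `p` and is NOT proved here. THEOREMS ONLY (0 definitions, 0 named facts,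
0 `sorry`). Every conclusion is CONDITIONAL on its displayed hypotheses: published named facts
(members of `PublishedFactsTwo`) and, at a member, DISPLAYED PER-CURVE CERTIFICATE DATA that are NOT
proved in the kernel (the analytic order `#Ш_an(E_p) = q` and `2`-descent data on `Ш(E_p)`).

## What the lower half needs, member by member

The LOWER inequality `ord₂ 𝔮 ≤ ord₂ #Ш(W)` is the half a `2`-descent does NOT bound in general
(descent bounds `Ш[2^∞]` from ABOVE only through the rank; from BELOW it must exhibit elements). This
file grades it by `n ≥ ord₂ #Ш_an` of the member and names the datum on `Ш(E_p)` that closes it in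
EVERY Heegner frame (`ord₂ 𝔮 = ord₂ #Ш_an` frame-independently, by the landed `L`-free identity —
x1b's `SylvesterTwo.padicValRat_cmHeegnerIndexQuotient_eq_of_shaAn_eq`, p417318):
* `n = 0` (`#Ш_an` odd): NOTHING on `Ш` (`lower_frame_of_shaAn_odd`) — 465 of the 507 members
  `p ≤ 20000` (cell data of record, bsd-cm-two N6-TABLE §T6/§21: `Ш(E_p) = 0` there) and x1b's
  `p = 13` witness;
* `n ≤ 2`: a Klein four-group inside `Ш(E_p)[2]` (`lower_frame_of_kleinFour`; §1: `4 ∣ #Ш`) — the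
  41 members with `#Ш_an = 4`, `dim Sel₂ = 3` (PARI `ellrank` `[1, 1, 2]`: the Cassels–Tate pairing on
  `Sel₂` has rank `2`, which exhibits the Klein four in `Ш[2]` outright);
* `n ≤ 4`: a Klein four-group inside `Ш(E_p)[2]` AND `Ш(E_p)[2] ⊆ 2·Ш(E_p)`
  (`lower_frame_of_kleinFour_twoDivisible`; §1: then `(ℤ/4)² ↪ Ш`, `16 ∣ #Ш`) — the ONE member
  `p ≤ 20000` where the lower half says more than a `2`-descent: `E_18913`, `#Ш_an = 16`,
  `ellrank = [1, 3, 0]` (`dim Sel₂ = 3`, Cassels–Tate on `Sel₂` IDENTICALLY ZERO ⟹ with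
  `rank E_18913(ℚ) = 1` and Cassels' kernel theorem, `Ш[2] ≅ (ℤ/2)² ⊆ 2·Ш`); instantiated in the
  sibling file `SylvesterTwoHeegnerIndexLowerHalfWitness18913`;
* and `upper_frame_iff_not_pow_succ_dvd`: at a member with `ord₂ #Ш_an = n` the UPPER inequality
  (crux 19229) is `¬ 2ⁿ⁺¹ ∣ #Ш(W)` — at `E_18913` the open `4`-Selmer Cassels–Tate question
  (note for seat bsd-cm-k7t-c2).
General form: `lower_frame_of_shaAn_of_pow_dvd_card` (`#Ш_an = q`, `ord₂ q ≤ n`, `2ⁿ ∣ #Ш(W)`).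
Evidence: kit j250083 (this seat: PARI `ellrank` + `bnfcertify` on all 507 members `p ≤ 20000`,
`E_18913` at effort 0/1/2) attached to item 19230; bsd-cm-two N6-TABLE §T6 (j240931–4, j243997–j244002).

PARTITION (D-0054): CornerF at `2` / O12 (CM, `r_an = 1`, `p = 2` non-split) × 𝒞_HSY members (per
member) × `p = 2` — per-pair certificate consumers; closes no cell and no class; nothing booked.
NOT a proof of the crux, of `BSD(E_p, 2)` for any `p` as a theorem of the kernel, or of any cell.
References (locators only): [HuShuYin2019] Thm. 1.3/1.4 (p. 3); [BurungaleFlach2024] Thm. 1.1,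
Cor. 2; [GrossZagier1986] I.6.3, V.§2; [Miller2011LMS] §1, Def. 1.1; [Cremona1997] §3.6
(`2`-descent); Cassels, J.W.S., "Second descents for elliptic curves", J. reine angew. Math. 494
(1998) 101–127 (the pairing on `Sel₂`; its kernel is the image of `Sel₄`); [KezukaLi2020] Thm. 1.3
(`Ш[2]` of cube-sum curves vs `2`-ranks of cubic class groups — the only printed relative).
-/

set_option autoImplicit false
-- the Theorems namespace `Summit.BirchSwinnertonDyer.BirchSwinnertonDyer.…` repeats a component by design (D-0017 layout)
set_option linter.dupNamespace false

noncomputable section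

open scoped Classical

open WeierstrassCurve NumberField Literature.NumberTheory.EllipticCurves
  Literature.NumberTheory.EllipticCurves.ModularForms
  Literature.NumberTheory.EllipticCurves.Rank1Residual
  Literature.NumberTheory.EllipticCurves.Rank1Residual.Typed
  Literature.NumberTheory.EllipticCurves.HuShuYin2019
  Summit.BirchSwinnertonDyer.Rank1Residual.P2
  Summit.BirchSwinnertonDyer.Rank1Residual.X12.Sylvester
  Summit.BirchSwinnertonDyer.BirchSwinnertonDyer.Theses.SylvesterTwoHeegnerIndex

namespace Summit.BirchSwinnertonDyer.BirchSwinnertonDyer.Theorems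

namespace SylvesterTwoLowerCert

/-! ## §1 Finite abelian groups: a Klein four in `G[2]`, and its halves -/

section GroupTheory

variable {G : Type*} [AddCommGroup G]

/-- Two distinct non-zero elements `x ≠ y` killed by `2` are `𝔽₂`-independent: an integer relation
`a • x + b • y = 0` has even coefficients. [folklore] -/
theorem two_dvd_of_rel {x y : G} (hx : (2 : ℤ) • x = 0) (hy : (2 : ℤ) • y = 0) (hx0 : x ≠ 0)
    (hy0 : y ≠ 0) (hxy : x ≠ y) (a b : ℤ) (h : a • x + b • y = 0) : 2 ∣ a ∧ 2 ∣ b := by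
  have hneg : -y = y := by
    rw [neg_eq_iff_add_eq_zero, ← two_zsmul]; exact hy
  have hev : ∀ (k : ℤ) (z : G), (2 : ℤ) • z = 0 → (2 * k) • z = 0 := fun k z hz => by
    rw [mul_comm, mul_smul, hz, smul_zero]
  have hodd : ∀ (k : ℤ) (z : G), (2 : ℤ) • z = 0 → (2 * k + 1) • z = z := fun k z hz => by
    rw [add_smul, hev k z hz, one_smul, zero_add]
  obtain ⟨k, rfl | rfl⟩ := Int.even_or_odd' a <;> obtain ⟨l, rfl | rfl⟩ := Int.even_or_odd' b
  · exact ⟨⟨k, rfl⟩, ⟨l, rfl⟩⟩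
  · rw [hev k x hx, hodd l y hy, zero_add] at h; exact absurd h hy0
  · rw [hodd k x hx, hev l y hy, add_zero] at h; exact absurd h hx0
  · rw [hodd k x hx, hodd l y hy, add_eq_zero_iff_eq_neg, hneg] at h; exact absurd h hxy

/-- **A Klein four-group inside `G` forces `4 ∣ #G`** (Lagrange; `#G = Nat.card G`, so for infinite
`G` the conclusion is the junk `4 ∣ 0`). [folklore] -/
theorem four_dvd_card_of_kleinFour {x y : G} (hx : (2 : ℤ) • x = 0) (hy : (2 : ℤ) • y = 0)
    (hx0 : x ≠ 0) (hy0 : y ≠ 0) (hxy : x ≠ y) : 4 ∣ Nat.card G := by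
  let fx : {f : ℤ →+ G // f (2 : ℕ) = 0} := ⟨zmultiplesHom G x, by simpa using hx⟩
  let fy : {f : ℤ →+ G // f (2 : ℕ) = 0} := ⟨zmultiplesHom G y, by simpa using hy⟩
  let F : ZMod 2 × ZMod 2 →+ G := (ZMod.lift 2 fx).coprod (ZMod.lift 2 fy)
  have hF : Function.Injective F := by
    refine (injective_iff_map_eq_zero F).mpr fun ab hab => ?_
    obtain ⟨a, b⟩ := ab
    obtain ⟨m, rfl⟩ := ZMod.intCast_surjective a
    obtain ⟨m', rfl⟩ := ZMod.intCast_surjective b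
    have h : m • x + m' • y = 0 := by
      simpa [F, fx, fy, AddMonoidHom.coprod_apply, ZMod.lift_coe] using hab
    obtain ⟨hm, hm'⟩ := two_dvd_of_rel hx hy hx0 hy0 hxy m m' h
    rw [Prod.mk_eq_zero, ZMod.intCast_zmod_eq_zero_iff_dvd, ZMod.intCast_zmod_eq_zero_iff_dvd]
    exact ⟨by exact_mod_cast hm, by exact_mod_cast hm'⟩
  have hcard : Nat.card (ZMod 2 × ZMod 2) = 4 := by
    rw [Nat.card_prod, Nat.card_zmod]
  exact hcard ▸ AddSubgroup.card_dvd_of_injective F hF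

/-- Halves of a Klein four: if `2 • x' = x`, `2 • y' = y` with `x, y` as above, an integer relation
`a • x' + b • y' = 0` has coefficients divisible by `4`. [folklore] -/
theorem four_dvd_of_rel_halves {x y x' y' : G} (hx : (2 : ℤ) • x = 0) (hy : (2 : ℤ) • y = 0)
    (hx0 : x ≠ 0) (hy0 : y ≠ 0) (hxy : x ≠ y) (hx' : (2 : ℤ) • x' = x) (hy' : (2 : ℤ) • y' = y)
    (a b : ℤ) (h : a • x' + b • y' = 0) : 4 ∣ a ∧ 4 ∣ b := by
  -- multiply the relation by 2: `a • x + b • y = 0`, so `a, b` are even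
  have h2 : a • x + b • y = 0 := by
    have := congrArg (fun z : G => (2 : ℤ) • z) h
    simp only [smul_add, smul_zero, smul_smul] at this
    rwa [mul_comm (2 : ℤ) a, mul_comm (2 : ℤ) b, mul_smul, mul_smul, hx', hy'] at this
  obtain ⟨⟨a₁, rfl⟩, ⟨b₁, rfl⟩⟩ := two_dvd_of_rel hx hy hx0 hy0 hxy a b h2
  -- `(2a₁) • x' + (2b₁) • y' = a₁ • x + b₁ • y = 0`, so `a₁, b₁` are even
  have h1 : a₁ • x + b₁ • y = 0 := by
    rwa [mul_comm (2 : ℤ) a₁, mul_comm (2 : ℤ) b₁, mul_smul, mul_smul, hx', hy'] at h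
  obtain ⟨⟨a₂, rfl⟩, ⟨b₂, rfl⟩⟩ := two_dvd_of_rel hx hy hx0 hy0 hxy a₁ b₁ h1
  exact ⟨⟨a₂, by ring⟩, ⟨b₂, by ring⟩⟩

/-- **A Klein four-group inside `G[2]` whose generators are halves, `x = 2x'`, `y = 2y'`, forces
`16 ∣ #G`**: `(a, b) ↦ a • x' + b • y'` embeds `(ℤ/4)²`. [folklore] -/
theorem sixteen_dvd_card_of_kleinFour_halves {x y x' y' : G} (hx : (2 : ℤ) • x = 0)
    (hy : (2 : ℤ) • y = 0) (hx0 : x ≠ 0) (hy0 : y ≠ 0) (hxy : x ≠ y) (hx' : (2 : ℤ) • x' = x)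
    (hy' : (2 : ℤ) • y' = y) : 16 ∣ Nat.card G := by
  have h4x : (zmultiplesHom G x') (4 : ℕ) = 0 := by
    change ((4 : ℕ) : ℤ) • x' = 0
    rw [show ((4 : ℕ) : ℤ) = 2 * 2 by norm_num, mul_smul, hx', hx]
  have h4y : (zmultiplesHom G y') (4 : ℕ) = 0 := by
    change ((4 : ℕ) : ℤ) • y' = 0
    rw [show ((4 : ℕ) : ℤ) = 2 * 2 by norm_num, mul_smul, hy', hy]
  let fx : {f : ℤ →+ G // f (4 : ℕ) = 0} := ⟨zmultiplesHom G x', h4x⟩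
  let fy : {f : ℤ →+ G // f (4 : ℕ) = 0} := ⟨zmultiplesHom G y', h4y⟩
  let F : ZMod 4 × ZMod 4 →+ G := (ZMod.lift 4 fx).coprod (ZMod.lift 4 fy)
  have hF : Function.Injective F := by
    refine (injective_iff_map_eq_zero F).mpr fun ab hab => ?_
    obtain ⟨a, b⟩ := ab
    obtain ⟨m, rfl⟩ := ZMod.intCast_surjective a
    obtain ⟨m', rfl⟩ := ZMod.intCast_surjective b
    have h : m • x' + m' • y' = 0 := by
      simpa [F, fx, fy, AddMonoidHom.coprod_apply, ZMod.lift_coe] using hab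
    obtain ⟨hm, hm'⟩ := four_dvd_of_rel_halves hx hy hx0 hy0 hxy hx' hy' m m' h
    rw [Prod.mk_eq_zero, ZMod.intCast_zmod_eq_zero_iff_dvd, ZMod.intCast_zmod_eq_zero_iff_dvd]
    exact ⟨by exact_mod_cast hm, by exact_mod_cast hm'⟩
  have hcard : Nat.card (ZMod 4 × ZMod 4) = 16 := by
    rw [Nat.card_prod, Nat.card_zmod]
  exact hcard ▸ AddSubgroup.card_dvd_of_injective F hF

/-- **`#G[4] ≥ #G[2]²`-type bound**: a Klein four-group inside `G[2]` together with
`G[2] ⊆ 2·G` (every element killed by `2` is a double) forces `16 ∣ #G`. This is the shape of the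
`E_18913` certificate: `Ш[2] ≅ (ℤ/2)²` and the Cassels–Tate pairing on `Ш[2]` trivial. [folklore] -/
theorem sixteen_dvd_card_of_kleinFour_of_twoDivisible {x y : G} (hx : (2 : ℤ) • x = 0)
    (hy : (2 : ℤ) • y = 0) (hx0 : x ≠ 0) (hy0 : y ≠ 0) (hxy : x ≠ y)
    (hdiv : ∀ z : G, (2 : ℤ) • z = 0 → ∃ w : G, (2 : ℤ) • w = z) : 16 ∣ Nat.card G := by
  obtain ⟨x', hx'⟩ := hdiv x hx
  obtain ⟨y', hy'⟩ := hdiv y hy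
  exact sixteen_dvd_card_of_kleinFour_halves hx hy hx0 hy0 hxy hx' hy'

end GroupTheory

/-! ## §2 Graded certificate consumers on 𝒞_HSY (every Heegner frame) -/

section Consumers

variable {p : ℕ} (W : WeierstrassCurve ℚ) [W.IsElliptic] [W.IsGloballyMinimal]

/-- **Graded LOWER-half consumer.** For `W ≅ E_p` in 𝒞_HSY with the displayed certificate
`#Ш_an(W) = q`, `ord₂ q ≤ n`, and `2ⁿ ∣ #Ш(W)`, the LOWER inequality `ord₂ 𝔮 ≤ ord₂ #Ш(W)` holds in
every Heegner frame `(N, K, Dt, H, ι, P, Wd, Cd, k)`: the landed `L`-free identity gives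
`ord₂ 𝔮 = ord₂ #Ш_an` (x1b's `SylvesterTwo.padicValRat_cmHeegnerIndexQuotient_eq_of_shaAn_eq`) and
`Ш(W)` is finite by Hu–Shu–Yin. Named facts as binders; per-pair EVIDENCE consumer.
[cite: HuShuYin2019, Thm. 1.3 and Thm. 1.4 (p. 3)] [cite: BurungaleFlach2024, Thm. 1.1 and Cor. 2]
[cite: Miller2011LMS, §1 and Def. 1.1] -/
theorem lower_frame_of_shaAn_of_pow_dvd_card
    (hHSY : thm14_threePart_product) (hBF : bsdTriple_of_hasCM_of_L_one_ne_zero)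
    (hmod : hasEntireLFunction_rat) (hGZK : rank_eq_analyticRank_of_analyticRank_le_one)
    (hp : p.Prime) (h9 : p % 9 = 4 ∨ p % 9 = 7) (h3 : ¬ ∃ x : ZMod p, x ^ 3 = 3)
    (hW : ∃ C : VariableChange ℚ, C • W = cubeSumCurve (p : ℚ))
    {q : ℚ} (hq : shaAn W = (q : ℂ)) {n : ℕ} (hv : padicValRat 2 q ≤ n)
    (hdvd : 2 ^ n ∣ Nat.card W.sha)
    (N : ℕ) [NeZero N] (K : Type) [Field K] [NumberField K]
    (Dt : ModularParametrizationData W N) (H : HeegnerDatum N (NumberField.discr K)) (ι : K →+* ℂ)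
    (P : (W.baseChange K).toAffine.Point)
    (hGZ : gross_zagier N W K) (hKo : kolyvagin N W K)
    (hK : IsImaginaryQuadratic K) (hHN : SatisfiesHeegnerHypothesis N K)
    (hP : WeierstrassCurve.Affine.Point.map ι.toRatAlgHom P = heegnerPointComplex Dt H)
    (hLt : (W.quadraticTwist (NumberField.discr K : ℚ)).entireLFunction 1 ≠ 0)
    (Wd : WeierstrassCurve ℚ) [Wd.IsElliptic] [Wd.IsGloballyMinimal] (Cd : VariableChange ℚ)
    (hWd : Cd • W.quadraticTwist (NumberField.discr K : ℚ) = Wd)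
    {k : ℕ} (hk : k = 1 ∨ k = 2)
    (hkiff : k = 2 ↔ ∀ y : W.toAffine.Point, ∃ Q : (W.baseChange K).toAffine.Point,
      QuadraticDescent.incl K W y - (2 : ℤ) • Q ∈ AddCommGroup.torsion (W.baseChange K).toAffine.Point) :
    padicValRat 2 (cmHeegnerIndexQuotient W K P Dt.c k Wd Cd.u) ≤ padicValNat 2 (Nat.card W.sha) := by
  haveI : Fact (Nat.Prime 2) := ⟨Nat.prime_two⟩
  obtain ⟨hr, hfin, -⟩ :=
    Summit.BirchSwinnertonDyer.Rank1Residual.X12.CubeSumFamilies.bsdp_three_of_thm14' hHSY hBF hmod hp h9 h3 W hW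
  haveI := hfin
  have hval := SylvesterTwo.padicValRat_cmHeegnerIndexQuotient_eq_of_shaAn_eq W N K Dt H ι P hGZ hKo
    hGZK hmod hBF (hasCM_of_model W hW) hK hHN hP hr hLt Wd Cd hWd hk hkiff hq
  have hcard : Nat.card W.sha ≠ 0 := (Nat.card_pos (α := W.sha)).ne'
  have hle : n ≤ padicValNat 2 (Nat.card W.sha) := (padicValNat_dvd_iff_le hcard).mp hdvd
  rw [hval]
  exact hv.trans (by exact_mod_cast hle)

/-- **`ord₂ #Ш_an ≤ 0` (e.g. `#Ш_an` odd): the LOWER inequality holds with NO datum on `Ш(W)`** —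
the case of 465 of the 507 members `p ≤ 20000` (and of x1b's `p = 13` witness). Per-pair EVIDENCE
consumer. [cite: HuShuYin2019, Thm. 1.3 and Thm. 1.4 (p. 3)] [cite: Miller2011LMS, §1 and Def. 1.1] -/
theorem lower_frame_of_shaAn_odd
    (hHSY : thm14_threePart_product) (hBF : bsdTriple_of_hasCM_of_L_one_ne_zero)
    (hmod : hasEntireLFunction_rat) (hGZK : rank_eq_analyticRank_of_analyticRank_le_one)
    (hp : p.Prime) (h9 : p % 9 = 4 ∨ p % 9 = 7) (h3 : ¬ ∃ x : ZMod p, x ^ 3 = 3)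
    (hW : ∃ C : VariableChange ℚ, C • W = cubeSumCurve (p : ℚ))
    {q : ℚ} (hq : shaAn W = (q : ℂ)) (hv : padicValRat 2 q ≤ 0)
    (N : ℕ) [NeZero N] (K : Type) [Field K] [NumberField K]
    (Dt : ModularParametrizationData W N) (H : HeegnerDatum N (NumberField.discr K)) (ι : K →+* ℂ)
    (P : (W.baseChange K).toAffine.Point)
    (hGZ : gross_zagier N W K) (hKo : kolyvagin N W K)
    (hK : IsImaginaryQuadratic K) (hHN : SatisfiesHeegnerHypothesis N K)
    (hP : WeierstrassCurve.Affine.Point.map ι.toRatAlgHom P = heegnerPointComplex Dt H)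
    (hLt : (W.quadraticTwist (NumberField.discr K : ℚ)).entireLFunction 1 ≠ 0)
    (Wd : WeierstrassCurve ℚ) [Wd.IsElliptic] [Wd.IsGloballyMinimal] (Cd : VariableChange ℚ)
    (hWd : Cd • W.quadraticTwist (NumberField.discr K : ℚ) = Wd)
    {k : ℕ} (hk : k = 1 ∨ k = 2)
    (hkiff : k = 2 ↔ ∀ y : W.toAffine.Point, ∃ Q : (W.baseChange K).toAffine.Point,
      QuadraticDescent.incl K W y - (2 : ℤ) • Q ∈ AddCommGroup.torsion (W.baseChange K).toAffine.Point) :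
    padicValRat 2 (cmHeegnerIndexQuotient W K P Dt.c k Wd Cd.u) ≤ padicValNat 2 (Nat.card W.sha) :=
  lower_frame_of_shaAn_of_pow_dvd_card W hHSY hBF hmod hGZK hp h9 h3 hW hq (n := 0)
    (by exact_mod_cast hv) (by rw [pow_zero]; exact one_dvd _) N K Dt H ι P hGZ hKo hK hHN hP hLt Wd
    Cd hWd hk hkiff

/-- **`ord₂ #Ш_an ≤ 2` and a Klein four-group in `Ш(W)[2]` ⟹ the LOWER inequality** (every frame)
— the case of the 41 members `p ≤ 20000` with `#Ш_an = 4`, `dim Sel₂(E_p) = 3` (cell data: PARI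
`ellrank` `[1, 1, 2]`, the pairing on `Sel₂` of rank `2` exhibits the Klein four in `Ш[2]` outright).
Per-pair EVIDENCE consumer. [cite: HuShuYin2019, Thm. 1.3 and Thm. 1.4 (p. 3)]
[cite: Miller2011LMS, §1 and Def. 1.1] [cite: Cremona1997, §3.6] -/
theorem lower_frame_of_kleinFour
    (hHSY : thm14_threePart_product) (hBF : bsdTriple_of_hasCM_of_L_one_ne_zero)
    (hmod : hasEntireLFunction_rat) (hGZK : rank_eq_analyticRank_of_analyticRank_le_one)
    (hp : p.Prime) (h9 : p % 9 = 4 ∨ p % 9 = 7) (h3 : ¬ ∃ x : ZMod p, x ^ 3 = 3)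
    (hW : ∃ C : VariableChange ℚ, C • W = cubeSumCurve (p : ℚ))
    {q : ℚ} (hq : shaAn W = (q : ℂ)) (hv : padicValRat 2 q ≤ 2)
    (hK4 : ∃ x y : W.sha, (2 : ℤ) • x = 0 ∧ (2 : ℤ) • y = 0 ∧ x ≠ 0 ∧ y ≠ 0 ∧ x ≠ y)
    (N : ℕ) [NeZero N] (K : Type) [Field K] [NumberField K]
    (Dt : ModularParametrizationData W N) (H : HeegnerDatum N (NumberField.discr K)) (ι : K →+* ℂ)
    (P : (W.baseChange K).toAffine.Point)
    (hGZ : gross_zagier N W K) (hKo : kolyvagin N W K)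
    (hK : IsImaginaryQuadratic K) (hHN : SatisfiesHeegnerHypothesis N K)
    (hP : WeierstrassCurve.Affine.Point.map ι.toRatAlgHom P = heegnerPointComplex Dt H)
    (hLt : (W.quadraticTwist (NumberField.discr K : ℚ)).entireLFunction 1 ≠ 0)
    (Wd : WeierstrassCurve ℚ) [Wd.IsElliptic] [Wd.IsGloballyMinimal] (Cd : VariableChange ℚ)
    (hWd : Cd • W.quadraticTwist (NumberField.discr K : ℚ) = Wd)
    {k : ℕ} (hk : k = 1 ∨ k = 2)
    (hkiff : k = 2 ↔ ∀ y : W.toAffine.Point, ∃ Q : (W.baseChange K).toAffine.Point,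
      QuadraticDescent.incl K W y - (2 : ℤ) • Q ∈ AddCommGroup.torsion (W.baseChange K).toAffine.Point) :
    padicValRat 2 (cmHeegnerIndexQuotient W K P Dt.c k Wd Cd.u) ≤ padicValNat 2 (Nat.card W.sha) := by
  obtain ⟨x, y, hx, hy, hx0, hy0, hxy⟩ := hK4
  exact lower_frame_of_shaAn_of_pow_dvd_card W hHSY hBF hmod hGZK hp h9 h3 hW hq (n := 2)
    (by exact_mod_cast hv) (by simpa using four_dvd_card_of_kleinFour hx hy hx0 hy0 hxy) N K Dt H ι
    P hGZ hKo hK hHN hP hLt Wd Cd hWd hk hkiff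

/-- **`ord₂ #Ш_an ≤ 4`, a Klein four-group in `Ш(W)[2]`, and `Ш(W)[2] ⊆ 2·Ш(W)` ⟹ the LOWER
inequality** (every frame) — the case of `E_18913` (`#Ш_an = 16`; `dim Sel₂ = 3`, Cassels–Tate on
`Sel₂` trivial: PARI `ellrank` `[1, 3, 0]`). Per-pair EVIDENCE consumer.
[cite: HuShuYin2019, Thm. 1.3 and Thm. 1.4 (p. 3)] [cite: Miller2011LMS, §1 and Def. 1.1]
[cite: Cremona1997, §3.6] -/
theorem lower_frame_of_kleinFour_twoDivisible
    (hHSY : thm14_threePart_product) (hBF : bsdTriple_of_hasCM_of_L_one_ne_zero)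
    (hmod : hasEntireLFunction_rat) (hGZK : rank_eq_analyticRank_of_analyticRank_le_one)
    (hp : p.Prime) (h9 : p % 9 = 4 ∨ p % 9 = 7) (h3 : ¬ ∃ x : ZMod p, x ^ 3 = 3)
    (hW : ∃ C : VariableChange ℚ, C • W = cubeSumCurve (p : ℚ))
    {q : ℚ} (hq : shaAn W = (q : ℂ)) (hv : padicValRat 2 q ≤ 4)
    (hK4 : ∃ x y : W.sha, (2 : ℤ) • x = 0 ∧ (2 : ℤ) • y = 0 ∧ x ≠ 0 ∧ y ≠ 0 ∧ x ≠ y)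
    (hdiv : ∀ z : W.sha, (2 : ℤ) • z = 0 → ∃ w : W.sha, (2 : ℤ) • w = z)
    (N : ℕ) [NeZero N] (K : Type) [Field K] [NumberField K]
    (Dt : ModularParametrizationData W N) (H : HeegnerDatum N (NumberField.discr K)) (ι : K →+* ℂ)
    (P : (W.baseChange K).toAffine.Point)
    (hGZ : gross_zagier N W K) (hKo : kolyvagin N W K)
    (hK : IsImaginaryQuadratic K) (hHN : SatisfiesHeegnerHypothesis N K)
    (hP : WeierstrassCurve.Affine.Point.map ι.toRatAlgHom P = heegnerPointComplex Dt H)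
    (hLt : (W.quadraticTwist (NumberField.discr K : ℚ)).entireLFunction 1 ≠ 0)
    (Wd : WeierstrassCurve ℚ) [Wd.IsElliptic] [Wd.IsGloballyMinimal] (Cd : VariableChange ℚ)
    (hWd : Cd • W.quadraticTwist (NumberField.discr K : ℚ) = Wd)
    {k : ℕ} (hk : k = 1 ∨ k = 2)
    (hkiff : k = 2 ↔ ∀ y : W.toAffine.Point, ∃ Q : (W.baseChange K).toAffine.Point,
      QuadraticDescent.incl K W y - (2 : ℤ) • Q ∈ AddCommGroup.torsion (W.baseChange K).toAffine.Point) :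
    padicValRat 2 (cmHeegnerIndexQuotient W K P Dt.c k Wd Cd.u) ≤ padicValNat 2 (Nat.card W.sha) := by
  obtain ⟨x, y, hx, hy, hx0, hy0, hxy⟩ := hK4
  exact lower_frame_of_shaAn_of_pow_dvd_card W hHSY hBF hmod hGZK hp h9 h3 hW hq (n := 4)
    (by exact_mod_cast hv)
    (by simpa using sixteen_dvd_card_of_kleinFour_of_twoDivisible hx hy hx0 hy0 hxy hdiv) N K Dt H ι
    P hGZ hKo hK hHN hP hLt Wd Cd hWd hk hkiff

/-- **What the UPPER half amounts to at a member with `ord₂ #Ш_an = n`:** in every frame,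
`ord₂ #Ш(W) ≤ ord₂ 𝔮 ⟺ ¬ 2ⁿ⁺¹ ∣ #Ш(W)`. At `E_18913` (`n = 4`): the crux `HeegnerIndexUpperAtTwoHSY`
(item 19229) holds at that member iff `32 ∤ #Ш(E_18913)`, i.e. iff `Ш(E_18913)[2^∞]` is EXACTLY
`(ℤ/4)²` — the `4`-Selmer Cassels–Tate computation the cell's engines do not have (note for seat
bsd-cm-k7t-c2). Per-pair EVIDENCE consumer. [cite: HuShuYin2019, Thm. 1.3 and Thm. 1.4 (p. 3)]
[cite: Miller2011LMS, §1 and Def. 1.1] -/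
theorem upper_frame_iff_not_pow_succ_dvd
    (hHSY : thm14_threePart_product) (hBF : bsdTriple_of_hasCM_of_L_one_ne_zero)
    (hmod : hasEntireLFunction_rat) (hGZK : rank_eq_analyticRank_of_analyticRank_le_one)
    (hp : p.Prime) (h9 : p % 9 = 4 ∨ p % 9 = 7) (h3 : ¬ ∃ x : ZMod p, x ^ 3 = 3)
    (hW : ∃ C : VariableChange ℚ, C • W = cubeSumCurve (p : ℚ))
    {q : ℚ} (hq : shaAn W = (q : ℂ)) {n : ℕ} (hv : padicValRat 2 q = n)
    (N : ℕ) [NeZero N] (K : Type) [Field K] [NumberField K]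
    (Dt : ModularParametrizationData W N) (H : HeegnerDatum N (NumberField.discr K)) (ι : K →+* ℂ)
    (P : (W.baseChange K).toAffine.Point)
    (hGZ : gross_zagier N W K) (hKo : kolyvagin N W K)
    (hK : IsImaginaryQuadratic K) (hHN : SatisfiesHeegnerHypothesis N K)
    (hP : WeierstrassCurve.Affine.Point.map ι.toRatAlgHom P = heegnerPointComplex Dt H)
    (hLt : (W.quadraticTwist (NumberField.discr K : ℚ)).entireLFunction 1 ≠ 0)
    (Wd : WeierstrassCurve ℚ) [Wd.IsElliptic] [Wd.IsGloballyMinimal] (Cd : VariableChange ℚ)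
    (hWd : Cd • W.quadraticTwist (NumberField.discr K : ℚ) = Wd)
    {k : ℕ} (hk : k = 1 ∨ k = 2)
    (hkiff : k = 2 ↔ ∀ y : W.toAffine.Point, ∃ Q : (W.baseChange K).toAffine.Point,
      QuadraticDescent.incl K W y - (2 : ℤ) • Q ∈ AddCommGroup.torsion (W.baseChange K).toAffine.Point) :
    ((padicValNat 2 (Nat.card W.sha) : ℤ) ≤ padicValRat 2 (cmHeegnerIndexQuotient W K P Dt.c k Wd Cd.u))
      ↔ ¬ 2 ^ (n + 1) ∣ Nat.card W.sha := by
  haveI : Fact (Nat.Prime 2) := ⟨Nat.prime_two⟩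
  obtain ⟨hr, hfin, -⟩ :=
    Summit.BirchSwinnertonDyer.Rank1Residual.X12.CubeSumFamilies.bsdp_three_of_thm14' hHSY hBF hmod hp h9 h3 W hW
  haveI := hfin
  have hval := SylvesterTwo.padicValRat_cmHeegnerIndexQuotient_eq_of_shaAn_eq W N K Dt H ι P hGZ hKo
    hGZK hmod hBF (hasCM_of_model W hW) hK hHN hP hr hLt Wd Cd hWd hk hkiff hq
  have hcard : Nat.card W.sha ≠ 0 := (Nat.card_pos (α := W.sha)).ne'
  rw [hval, hv, padicValNat_dvd_iff_le hcard, not_le, Nat.lt_succ_iff]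
  exact ⟨fun h => by exact_mod_cast h, fun h => by exact_mod_cast h⟩

end Consumers

end SylvesterTwoLowerCert

end Summit.BirchSwinnertonDyer.BirchSwinnertonDyer.Theorems

end
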